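import Summits.ValiantsHypothesis.ValiantsHypothesis.Theorems.FifoMatchingNNDivisionHardExactPencilWindow
import HarnessLib

/-!
# EXACT PENCILS XIV — ★★★ STICK-OUT / FAT CUBES DECIDED AT POLYLOG SCALE (`cor_add_bound_of_stickOutCube`, `cor_add_stickOutCube_decided`, `cor_add_fatCube_decided`, `cor_add_fatColumnsCube_decided`, `cor_add_fatRowsCube_decided`): the CUBE instance of the EDGE-form engine `cor_add_bound_of_edgesReadD` at the located pair `(Z, β) = (ιᶜ, singletons)` (crux `NNDivisionHard`, stmt-ValiantsHypothesis-21181) — `ExactPencil` port part 14/14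

Theorems-side port (staged by val-idea-40 g6, C′-census owner per director-valiant R331 (2)(e) / R336 (2) / desk #399 / #430, for the port hands;
press as `Theorems/FifoMatchingNNDivisionHardExactPencilStickOut.lean`, `--kind proof --supports stmt-ValiantsHypothesis-21181 --as helper`, AFTER part 13
and AFTER val-idea-crit-9 g3's price of val-idea-38 g3's sig-first 02:02:43Z) of val-idea-38 g3's `section StickOut` (bytes `pub/ideators/val-idea-38/StickOut38_section.lean`,
sha16 b98220aa14e44726, 205 l.; certified by its author appended to the 13-part scratch 969095cfec42ca18, and re-certified here over the amended chain).
Declaration texts VERBATIM and already in the port namespace `…Theorems.FifoMatching.ExactPencil` (two one-line docstrings added: `cubePt_eq_flat_cubeQ`,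
`card_sub_card_compl`).  Part 14/14 of the port (imports part 13, `…Theorems.FifoMatchingNNDivisionHardExactPencilWindow`).

* §13b `sum_mem_eq_sum_univ_ite'`, `sum_symmDiff_singleton_sub` (flip one generator), `symmDiff_singleton_injOn`, `symmDiff_symmDiff_singleton`,
  ★ `sum_sub_sum_eq_sum_flips` (the CUBE CONE CERTIFICATE `q_{P'} − q_P = Σ_t 𝟙[t ∈ P ∆ P']·(q_{P∆{t}} − q_P)`), `cubeQ`, `cubePt_eq_flat_cubeQ`, `cubeNbr`, `cubeQ_flip_sub`,
  `cube_hcone`, `cube_hw`, `card_sub_card_compl`, ★★★ `cor_add_bound_of_stickOutCube` (every nonzero generator has a nonzero entry outside `ι × ι` ⟹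
  `3^{|ι|} ≤ (r+1)·2^{|ι|}`), `exactTilted_lawBody_stickOutCube` (same in C′'s literal law-body currency), ★★★ `cor_add_stickOutCube_decided` (`|ι| ≥ K(c,n) = 2(log₂ n + c)^c + 6`
  ⟹ `T c n < r`, via part 13's `T_lt_of_block_uniform`), ★★★ `cor_add_fatCube_decided` (NO nonzero generator fits inside a `K(c,n) × K(c,n)` principal block ⟹ decided;
  every `n` with `K(c,n) ≤ n`, budget-free, any number of generators), ★★★ `cor_add_fatColumnsCube_decided` / `cor_add_fatRowsCube_decided` (`> K(c,n)` nonzero columns / rows per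
  nonzero generator).

CURRENCY: C′ = `LocatedRows.ExactPencilLaw` = the exact-pencil form of COR-VIRTUAL (`exactPencilLaw_iff_corVirtualHardN` ✓ p688316, `…_iff_corVirtualHard` ✓ p688396);
«law body» vs «top law» is a proof-route distinction.  HONEST LABEL: instance theorems (a DECIDED SPECIES, genus I) of the OPEN law C′ ≡ COR-VIRTUAL; the crux
21181 `NNDivisionHard` is OPEN; `CoreLawOrb` OPEN; `LocatedPencilLaw` REFUTED (✓ p679540).  VP ≠ VNP is NOT proved here or anywhere in this tree.
-/

set_option autoImplicit false

-- the mandated summit-side namespace repeats a component by design (single-problem summit)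
set_option linter.dupNamespace false

noncomputable section

open Matrix Finset
open scoped Pointwise


/-! ### §13b (val-idea-38 g3) STICK-OUT CUBES AT POLYLOG SCALE — the cube cone certificate (flip one generator) fed to
★★★ `cor_add_bound_of_edgesReadD` with `β = σ = id`, dead set `D = ιᶜ`, readers `Es x y`, `(x, y) ∉ ι × ι`, then `T_lt_of_block_uniform`:
a full affine cube `{Q₀ + Σ_{t∈P} G t : P ⊆ [N]}` every nonzero generator of which has a nonzero entry OUTSIDE `ι × ι` obeys
`3^{|ι|} ≤ (r+1)·2^{|ι|}`, hence is DECIDED (`T c n < r`) as soon as `|ι| ≥ K(c,n) := 2(log₂ n + c)^c + 6` — POLYLOG, every `n`, budget-free,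
any number of generators.  Consequences: `cubeFat` threshold `K(c,n) + 1` columns (val-idea-43 g6 S43-4 used `⌊√h⌋ + 1`); a residual
cube list must place a nonzero generator INSIDE every `K(c,n)`-principal block. -/

namespace Summit.ValiantsHypothesis.ValiantsHypothesis.Theorems.FifoMatching.ExactPencil

open Literature.Barriers.PneNP (HasEFOfSize)
open Literature.Combinatorics.Optimization.FixedSizePsdRank (corPolytope flat)
open Summit.ValiantsHypothesis.ValiantsHypothesis.Theorems.FifoMatching.XcDivision (udPt)
open Summit.ValiantsHypothesis.ValiantsHypothesis.Theorems.FifoMatching.LocatedRows (T exactTilted cubePt flat_add' flat_sum')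

section StickOut

variable {n : ℕ}

/-- a sum over a subset as an indicator sum over `univ`. -/
theorem sum_mem_eq_sum_univ_ite' {α V : Type*} [Fintype α] [DecidableEq α] [AddCommMonoid V] (X : Finset α) (f : α → V) :
    ∑ t ∈ X, f t = ∑ t, (if t ∈ X then f t else 0) := by
  rw [Finset.sum_ite_mem, Finset.univ_inter]

/-- flipping one generator: the sum over `P ∆ {t}` minus the sum over `P` is `∓ f t`. -/
theorem sum_symmDiff_singleton_sub {α V : Type*} [DecidableEq α] [AddCommGroup V] (P : Finset α) (t : α) (f : α → V) :
    ∑ s ∈ symmDiff P {t}, f s - ∑ s ∈ P, f s = if t ∈ P then -f t else f t := by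
  by_cases ht : t ∈ P
  · have h1 : symmDiff P {t} = P.erase t := by
      ext s
      simp only [Finset.mem_symmDiff, Finset.mem_singleton, Finset.mem_erase]
      constructor
      · rintro (⟨hs, hst⟩ | ⟨rfl, hs⟩)
        · exact ⟨hst, hs⟩
        · exact absurd ht hs
      · rintro ⟨hst, hs⟩
        exact Or.inl ⟨hs, hst⟩
    rw [h1, if_pos ht, ← Finset.sum_erase_add P f ht]
    abel
  · have h1 : symmDiff P {t} = insert t P := by
      ext s
      simp only [Finset.mem_symmDiff, Finset.mem_singleton, Finset.mem_insert]
      constructor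
      · rintro (⟨hs, _⟩ | ⟨rfl, _⟩)
        · exact Or.inr hs
        · exact Or.inl rfl
      · rintro (rfl | hs)
        · exact Or.inr ⟨rfl, ht⟩
        · exact Or.inl ⟨hs, fun h => ht (h ▸ hs)⟩
    rw [h1, if_neg ht, Finset.sum_insert ht]
    abel

/-- `t ↦ P ∆ {t}` is injective. -/
theorem symmDiff_singleton_injOn {α : Type*} [DecidableEq α] (P S : Finset α) :
    Set.InjOn (fun t : α => symmDiff P {t}) ↑S := by
  intro t _ t' _ h
  exact Finset.singleton_injective (symmDiff_right_injective P h)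

/-- the flip `P ∆ {t}` differs from `P` exactly in `{t}`. -/
theorem symmDiff_symmDiff_singleton {α : Type*} [DecidableEq α] (P : Finset α) (t : α) :
    symmDiff (symmDiff P {t}) P = {t} := by
  rw [symmDiff_comm (symmDiff P {t}) P, symmDiff_symmDiff_cancel_left]

/-- ★ the CUBE CONE CERTIFICATE: `q_{P'} − q_P = Σ_t 𝟙[t ∈ P ∆ P'] · (q_{P ∆ {t}} − q_P)` (flip exactly the generators in `P ∆ P'`;
the coefficient is written as `𝟙[(P ∆ {t}) ∆ P ⊆ P ∆ P']` so that it is a function of the neighbour `P ∆ {t}`). -/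
theorem sum_sub_sum_eq_sum_flips {α V : Type*} [Fintype α] [DecidableEq α] [AddCommGroup V] [Module ℝ V]
    (P P' : Finset α) (f : α → V) :
    ∑ s ∈ P', f s - ∑ s ∈ P, f s = ∑ t, (if symmDiff (symmDiff P {t}) P ⊆ symmDiff P P' then (1 : ℝ) else 0) •
      (∑ s ∈ symmDiff P {t}, f s - ∑ s ∈ P, f s) := by
  simp_rw [symmDiff_symmDiff_singleton, Finset.singleton_subset_iff, sum_symmDiff_singleton_sub]
  rw [sum_mem_eq_sum_univ_ite' P', sum_mem_eq_sum_univ_ite' P, ← Finset.sum_sub_distrib]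
  refine Finset.sum_congr rfl fun t _ => ?_
  by_cases hP : t ∈ P <;> by_cases hP' : t ∈ P' <;> simp [hP, hP', Finset.mem_symmDiff]

/-- the cube vertex as a MATRIX: `cubeQ Q₀ G P = Q₀ + Σ_{t∈P} G t` (so `cubePt Q₀ G P = flat (cubeQ Q₀ G P)` by `rfl`). -/
def cubeQ {N : ℕ} (Q₀ : Matrix (Fin n) (Fin n) ℝ) (G : Fin N → Matrix (Fin n) (Fin n) ℝ) (P : Finset (Fin N)) :
    Matrix (Fin n) (Fin n) ℝ :=
  Q₀ + ∑ t ∈ P, G t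

/-- the located passenger of a cube is the flattening of its matrix vertices (`rfl`). -/
theorem cubePt_eq_flat_cubeQ {N : ℕ} (Q₀ : Matrix (Fin n) (Fin n) ℝ) (G : Fin N → Matrix (Fin n) (Fin n) ℝ) :
    cubePt Q₀ G = fun P => flat (cubeQ Q₀ G P) := rfl

/-- the cube's neighbour structure: flip one generator. -/
def cubeNbr {N : ℕ} (P : Finset (Fin N)) : Finset (Finset (Fin N)) :=
  Finset.univ.image (fun t => symmDiff P {t})

/-- an edge of the cube moves by `∓ G t`. -/
theorem cubeQ_flip_sub {N : ℕ} (Q₀ : Matrix (Fin n) (Fin n) ℝ) (G : Fin N → Matrix (Fin n) (Fin n) ℝ)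
    (P : Finset (Fin N)) (t : Fin N) :
    cubeQ Q₀ G (symmDiff P {t}) - cubeQ Q₀ G P = if t ∈ P then -G t else G t := by
  unfold cubeQ
  rw [add_sub_add_left_eq_sub]
  exact sum_symmDiff_singleton_sub P t G

/-- ★ the cube cone certificate in the `hcone` currency of `cor_add_bound_of_edgesReadD`. -/
theorem cube_hcone {N : ℕ} (Q₀ : Matrix (Fin n) (Fin n) ℝ) (G : Fin N → Matrix (Fin n) (Fin n) ℝ) (P P' : Finset (Fin N)) :
    ∃ c : Finset (Fin N) → ℝ, (∀ e, 0 ≤ c e) ∧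
      flat (cubeQ Q₀ G P') - flat (cubeQ Q₀ G P) = ∑ e ∈ cubeNbr P, c e • (flat (cubeQ Q₀ G e) - flat (cubeQ Q₀ G P)) := by
  refine ⟨fun e => if symmDiff e P ⊆ symmDiff P P' then 1 else 0, fun e => by dsimp only; split_ifs <;> norm_num, ?_⟩
  have hq : ∀ X : Finset (Fin N), flat (cubeQ Q₀ G X) = flat Q₀ + ∑ s ∈ X, flat (G s) := fun X => by
    unfold cubeQ
    rw [flat_add', flat_sum']
  unfold cubeNbr
  rw [Finset.sum_image (symmDiff_singleton_injOn P _)]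
  simp_rw [hq, add_sub_add_left_eq_sub]
  exact sum_sub_sum_eq_sum_flips P P' (fun s => flat (G s))

/-- ★ the `hw` currency: every cube EDGE direction `∓ G t ≠ 0` is read by a dead elementary reader `Es x y`, `x ∉ ι ∨ y ∉ ι`
(dead set `D = ιᶜ`, `β = id`), provided every nonzero generator has a nonzero entry outside `ι × ι`. -/
theorem cube_hw {N : ℕ} (ι : Finset (Fin n)) (Q₀ : Matrix (Fin n) (Fin n) ℝ) (G : Fin N → Matrix (Fin n) (Fin n) ℝ)
    (hG : ∀ t, G t ≠ 0 → ∃ x y, G t x y ≠ 0 ∧ (x ∉ ι ∨ y ∉ ι)) :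
    ∀ P, ∀ e ∈ cubeNbr P, cubeQ Q₀ G e ≠ cubeQ Q₀ G P →
      ∃ U, faceZeroD id ιᶜ U ∧ flat U ⬝ᵥ flat (cubeQ Q₀ G e - cubeQ Q₀ G P) ≠ 0 := by
  intro P e he hne
  unfold cubeNbr at he
  obtain ⟨t, -, rfl⟩ := Finset.mem_image.1 he
  have hd := cubeQ_flip_sub Q₀ G P t
  have hGt : G t ≠ 0 := by
    intro h0
    apply hne
    rw [← sub_eq_zero, hd, h0, neg_zero, ite_self]
  obtain ⟨x, y, hxy, hout⟩ := hG t hGt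
  refine ⟨Es x y, Es_faceZeroD id ιᶜ ?_, ?_⟩
  · rcases hout with hx | hy
    · exact Or.inl (Finset.mem_compl.2 hx)
    · exact Or.inr (Finset.mem_compl.2 hy)
  · rw [flat_Es_dotProduct_flat, hd]
    split_ifs
    · rw [Matrix.neg_apply]
      exact neg_ne_zero.2 hxy
    · exact hxy

/-- `n − |ιᶜ| = |ι|` for `ι ⊆ Fin n`. -/
theorem card_sub_card_compl (ι : Finset (Fin n)) : n - ιᶜ.card = ι.card := by
  rw [Finset.card_compl, Fintype.card_fin]
  have := ι.card_le_univ
  rw [Fintype.card_fin] at this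
  omega

/-- ★★★ **STICK-OUT CUBES KEEP THE `ι`-BLOCK** (COR-Minkowski currency, budget-free, every `n`, any number `N` of generators):
if every nonzero generator has a nonzero entry outside `ι × ι`, then `3^{|ι|} ≤ (r+1)·2^{|ι|}` for every EF of size `r` of
`COR(n) + cube`.  Proof: ★★★ `cor_add_bound_of_edgesReadD` with `β = σ = id`, `D = ιᶜ`, `cube_hcone`, `cube_hw`. -/
theorem cor_add_bound_of_stickOutCube {N : ℕ} (ι : Finset (Fin n)) (Q₀ : Matrix (Fin n) (Fin n) ℝ)
    (G : Fin N → Matrix (Fin n) (Fin n) ℝ) (hG : ∀ t, G t ≠ 0 → ∃ x y, G t x y ≠ 0 ∧ (x ∉ ι ∨ y ∉ ι)) (r : ℕ)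
    (hEF : HasEFOfSize (corPolytope n + convexHull ℝ (Set.range (cubePt Q₀ G))) r) :
    3 ^ ι.card ≤ (r + 1) * 2 ^ ι.card := by
  rw [cubePt_eq_flat_cubeQ] at hEF
  have key := cor_add_bound_of_edgesReadD (β := id) (σ := id) (fun _ => rfl) ιᶜ (cubeQ Q₀ G) cubeNbr
    (cube_hcone Q₀ G) (cube_hw ι Q₀ G hG) r hEF
  rwa [card_sub_card_compl] at key

/-- the same in C′'s literal LAW-BODY currency (`exactTilted`, listed passenger `cubeQ Q₀ G ∘ e`… here indexed by all `P`). -/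
theorem exactTilted_lawBody_stickOutCube {N : ℕ} (ι : Finset (Fin n)) (Q₀ : Matrix (Fin n) (Fin n) ℝ)
    (G : Fin N → Matrix (Fin n) (Fin n) ℝ) (hG : ∀ t, G t ≠ 0 → ∃ x y, G t x y ≠ 0 ∧ (x ∉ ι ∨ y ∉ ι)) (r : ℕ)
    (mm : exactTilted.A n → ℝ) (hle : ∀ a P, exactTilted.ρ n a ⬝ᵥ cubePt Q₀ G P ≤ mm a)
    (hat : ∀ a, ∃ P, exactTilted.ρ n a ⬝ᵥ cubePt Q₀ G P = mm a)
    (U : exactTilted.A n → Option (Fin r) → ℝ) (V : Finset (Fin n) × Finset (Fin N) → Option (Fin r) → ℝ)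
    (hU : ∀ a i, 0 ≤ U a i) (hV : ∀ p i, 0 ≤ V p i)
    (hfac : ∀ a b P, (exactTilted.β n a + mm a) - exactTilted.ρ n a ⬝ᵥ (udPt b + cubePt Q₀ G P) = ∑ i, U a i * V (b, P) i) :
    3 ^ ι.card ≤ (r + 1) * 2 ^ ι.card := by
  have key := exactTilted_lawBody_of_edgesReadD (β := id) (σ := id) (fun _ => rfl) ιᶜ (cubeQ Q₀ G) cubeNbr
    (cube_hcone Q₀ G) (cube_hw ι Q₀ G hG) r mm hle hat U V hU hV hfac
  rwa [card_sub_card_compl] at key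

/-- ★★★ rate form: `|ι| ≥ K(c,n) = 2(log₂ n + c)^c + 6` (POLYLOG) ⇒ `xc > T c n`, every `n`, budget-free. -/
theorem cor_add_stickOutCube_decided (c : ℕ) {N : ℕ} (ι : Finset (Fin n)) (hι : 2 * (Nat.log 2 n + c) ^ c + 6 ≤ ι.card)
    (Q₀ : Matrix (Fin n) (Fin n) ℝ) (G : Fin N → Matrix (Fin n) (Fin n) ℝ)
    (hG : ∀ t, G t ≠ 0 → ∃ x y, G t x y ≠ 0 ∧ (x ∉ ι ∨ y ∉ ι)) (r : ℕ)
    (hEF : HasEFOfSize (corPolytope n + convexHull ℝ (Set.range (cubePt Q₀ G))) r) : T c n < r :=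
  T_lt_of_block_uniform c n ι.card r hι (cor_add_bound_of_stickOutCube ι Q₀ G hG r hEF)

/-- ★★★ **FAT CUBES ARE DECIDED AT POLYLOG SCALE**: if no nonzero generator fits inside a `K(c,n) × K(c,n)` principal block
(`K(c,n) = 2(log₂ n + c)^c + 6 ≤ n`), then `xc(COR(n) + cube) > T c n` — every such `n`, budget-free, any `N`. -/
theorem cor_add_fatCube_decided (c : ℕ) {N : ℕ} (hKn : 2 * (Nat.log 2 n + c) ^ c + 6 ≤ n)
    (Q₀ : Matrix (Fin n) (Fin n) ℝ) (G : Fin N → Matrix (Fin n) (Fin n) ℝ)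
    (hfat : ∀ t, G t ≠ 0 → ∀ ι : Finset (Fin n), ι.card ≤ 2 * (Nat.log 2 n + c) ^ c + 6 →
      ∃ x y, G t x y ≠ 0 ∧ (x ∉ ι ∨ y ∉ ι)) (r : ℕ)
    (hEF : HasEFOfSize (corPolytope n + convexHull ℝ (Set.range (cubePt Q₀ G))) r) : T c n < r := by
  obtain ⟨ι, -, hι⟩ := Finset.exists_subset_card_eq (s := (Finset.univ : Finset (Fin n)))
    (n := 2 * (Nat.log 2 n + c) ^ c + 6) (by rw [Finset.card_univ, Fintype.card_fin]; exact hKn)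
  exact cor_add_stickOutCube_decided c ι hι.ge Q₀ G (fun t ht => hfat t ht ι hι.le) r hEF

/-- ★★★ the COLUMN form (val-idea-43 g6's S43-4 «stick-out cubes» hypothesis, at POLYLOG instead of `⌊√n⌋` scale): every nonzero
generator has MORE THAN `K(c,n)` nonzero columns (witnessed by `cols t`) ⇒ decided.  (Rows: the same proof with `Or.inl`.) -/
theorem cor_add_fatColumnsCube_decided (c : ℕ) {N : ℕ} (hKn : 2 * (Nat.log 2 n + c) ^ c + 6 ≤ n)
    (Q₀ : Matrix (Fin n) (Fin n) ℝ) (G : Fin N → Matrix (Fin n) (Fin n) ℝ) (cols : Fin N → Finset (Fin n))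
    (hcols : ∀ t, ∀ y ∈ cols t, ∃ x, G t x y ≠ 0) (hfat : ∀ t, G t ≠ 0 → 2 * (Nat.log 2 n + c) ^ c + 6 < (cols t).card)
    (r : ℕ) (hEF : HasEFOfSize (corPolytope n + convexHull ℝ (Set.range (cubePt Q₀ G))) r) : T c n < r :=
  cor_add_fatCube_decided c hKn Q₀ G (fun t ht ι hι => by
    obtain ⟨y, hy, hyι⟩ := Finset.exists_mem_notMem_of_card_lt_card (lt_of_le_of_lt hι (hfat t ht))
    obtain ⟨x, hx⟩ := hcols t y hy
    exact ⟨x, y, hx, Or.inr hyι⟩) r hEF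

/-- the ROW form. -/
theorem cor_add_fatRowsCube_decided (c : ℕ) {N : ℕ} (hKn : 2 * (Nat.log 2 n + c) ^ c + 6 ≤ n)
    (Q₀ : Matrix (Fin n) (Fin n) ℝ) (G : Fin N → Matrix (Fin n) (Fin n) ℝ) (rows : Fin N → Finset (Fin n))
    (hrows : ∀ t, ∀ x ∈ rows t, ∃ y, G t x y ≠ 0) (hfat : ∀ t, G t ≠ 0 → 2 * (Nat.log 2 n + c) ^ c + 6 < (rows t).card)
    (r : ℕ) (hEF : HasEFOfSize (corPolytope n + convexHull ℝ (Set.range (cubePt Q₀ G))) r) : T c n < r :=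
  cor_add_fatCube_decided c hKn Q₀ G (fun t ht ι hι => by
    obtain ⟨x, hx, hxι⟩ := Finset.exists_mem_notMem_of_card_lt_card (lt_of_le_of_lt hι (hfat t ht))
    obtain ⟨y, hy⟩ := hrows t x hx
    exact ⟨x, y, hy, Or.inl hxι⟩) r hEF

end StickOut

end Summit.ValiantsHypothesis.ValiantsHypothesis.Theorems.FifoMatching.ExactPencil
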